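/-
Copyright (c) 2026 the pub-hodgecm-mathlib formalisation cell (harness21).  Prover seat hodgecm-mathlib-F0P3a-p04 (g19): road «S3-ram» (LEAD F0P3a-plan (g13); junction
pen F0P3a-p01 (g17), J-PACK v2 assembly lemma L3 (skeleton v10, GEN depth-capped form); owner F0P3a-p06 (g15)); 2026-09-02.
-/
import Literature.NumberTheory.Automorphic.UnitaryLatticeTreeEngineRowsGenRamified           -- ★-to-be (this seat): PART 2 (GEN rows hodd hB hC hR hE, nilpotency under the cap)
import Literature.NumberTheory.Automorphic.UnitaryLatticeTreeFixedRowOddRamified             -- ★ ROW-O (F0P2-p06)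
import Literature.NumberTheory.Automorphic.UnitaryLatticeTreeFixedRowRankOneRamified         -- ★ ROW-P (F0P2-p01)
import Literature.NumberTheory.Automorphic.UnitaryLatticeTreeRankOneVertexOneClassRamified   -- ★ ROW-1C ED. 2 (F0P3a-p05)
import Literature.NumberTheory.Automorphic.UnitaryLatticeTreeStarOfInvolution              -- ★ alternation `isSelfDualLattice_iff_not_isSelfDualLattice_of_adj_of_v`
import HarnessLib

/-!
# The lattice graph of a hermitian space — THE ENGINE'S LOCAL-LAW BINDERS FROM THE ★ ROWS (GEN, depth-capped), PART 3: the odd rows `hO hP` and the head `engineRows_of_rows`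
# (Kottwitz 1986 §3; Rogawski 1990 §4.9; Bruhat–Tits 1972 §10)

Topic `NumberTheory/Automorphic`; namespace `Literature.NumberTheory.Automorphic.UnitaryLatticeTree`.  THEOREMS ONLY (no definition, no instance, no notation, no named fact,
no `sorry`); kernel lane `--supports stmt-HodgeConjecture-24833`.  Cell `pub/hodgecm-mathlib` (D-0151), crux H413; road «S3-ram» (Literature seeding, count-neutral); the
(a2) JUNCTION (pen F0P3a-p01 (g17), skeleton v10 60042d5ba750b772 :627): assembly lemma **L3 `engineRows_of_rows`**, PART 3 = the odd rows and the head, GEN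
(depth-capped) dialect.  §1 `cls_of_cls_of_congr` (the class token only sees residual unit squares), `isSelfDualLattice_of_mem_gc` (grandchildren of a self-dual vertex
are self-dual: two steps of the bipartite alternation).  §2 **`engineRowGen_O`** — a REGULAR odd vertex `(2m+3, 2)` with `2m+3 < D` has fixed grandchildren `(2m+2, 2)` or
`(2m+1, 1, ±)`, numbering `q`, `C(q,2)`, `C(q,2)` (★ ROW-O at the free class constant `c := c₁`); **`engineRowGen_P`** — a RANK-ONE odd vertex `(2m+3, 1, c)` has `q²`
fixed grandchildren, all `(2m+1, 1, sgn·c)`, `sgn = χ(−1)`: ★ ROW-P at the class constant `c₁` (if `cl v = 1`) or `c₁ε` (if `cl v = −1`, by ★ ROW-1C at `v`), whose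
grandchildren carry the NEGATED class; the dictionary `hsgnDict` («`−c ∈ c□` iff `−1 ∈ □`; else `−c ∈ cε□` and `−cε ∈ c□`») and ★ ROW-1C at the grandchild turn
`CLS(−c′)` into `cl w = sgn·c`.  §3 the head **`engineRows_of_rows`** = the pen's v10 socket text VERBATIM (unused binders `_`-prefixed), by the seven rows.

HONEST LABEL: HC_CM is proved only modulo the 2 remaining named inputs (hLiu418 24832, h413 24833) until rung 0 closes; nothing printed is asserted here (bookkeeping over
★ rows); «S3-ram» has no books consequence.

## References
* [Kottwitz1986] R. E. Kottwitz, *Base change for unit elements of Hecke algebras*, Compositio Math. 60 (1986), §3.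
* [Rogawski1990] J. D. Rogawski, *Automorphic Representations of Unitary Groups in Three Variables*, Ann. of Math. Stud. 123 (1990), §4.9 pp. 54–56.
* [BruhatTits1972] F. Bruhat, J. Tits, *Groupes réductifs sur un corps local I*, Publ. Math. IHÉS 41 (1972), §10.
* [Serre1980Trees] J.-P. Serre, *Trees* (1980), Ch. II §1.1.
-/

set_option autoImplicit false

noncomputable section

open scoped Valued WithZero Matrix MatrixGroups
open Polynomial Classical

namespace Literature.NumberTheory.Automorphic.UnitaryLatticeTree

open Literature.NumberTheory.Automorphic Literature.NumberTheory.Automorphic.HermitianLattice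

variable {K : Type*} [Field K] [Valued K ℤᵐ⁰] {σ : K →+* K} {ϖ : K}

/-! ## §1 The class token only sees unit squares; grandchildren are self-dual -/

/-- **The class token is invariant under residual unit squares**: `CLS[w](e)(x)` and `|x − x′·z²| < 1` with `|z| = 1` give `CLS[w](e)(x′)` (witness `a ↦ z·a`).
[cite: Kottwitz1986, §3] -/
theorem cls_of_cls_of_congr {γ : unitaryGroupOfForm σ ((StdForm.antidiagonal 3).over K)} (w : {M : Submodule 𝒪[K] (Fin 3 → K) // IsVertex σ ϖ ((StdForm.antidiagonal 3).over K) M}) (e : ℕ) {x x' z : K} (hz : Valued.v z = 1)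
    (hxx' : Valued.v (x - x' * z ^ 2) < 1) (h : (∃ y ∈ w.1, ∃ a : K, Valued.v a = 1 ∧ Valued.v ((ϖ ^ (e))⁻¹ * pairing σ ((StdForm.antidiagonal 3).over K) y ((((γ : GL (Fin 3) K) : Matrix (Fin 3) (Fin 3) K) - 1) *ᵥ y) - (x) * a ^ 2) < 1)) : (∃ y ∈ w.1, ∃ a : K, Valued.v a = 1 ∧ Valued.v ((ϖ ^ (e))⁻¹ * pairing σ ((StdForm.antidiagonal 3).over K) y ((((γ : GL (Fin 3) K) : Matrix (Fin 3) (Fin 3) K) - 1) *ᵥ y) - (x') * a ^ 2) < 1) := by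
  obtain ⟨y, hy, a, ha, hlt⟩ := h
  refine ⟨y, hy, z * a, by rw [map_mul, hz, ha, mul_one], ?_⟩
  have e' : (ϖ ^ e)⁻¹ * pairing σ ((StdForm.antidiagonal 3).over K) y ((((γ : GL (Fin 3) K) : Matrix (Fin 3) (Fin 3) K) - 1) *ᵥ y) - x' * (z * a) ^ 2 =
      ((ϖ ^ e)⁻¹ * pairing σ ((StdForm.antidiagonal 3).over K) y ((((γ : GL (Fin 3) K) : Matrix (Fin 3) (Fin 3) K) - 1) *ᵥ y) - x * a ^ 2) + (x - x' * z ^ 2) * a ^ 2 := by ring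
  rw [e']
  refine Valuation.map_add_lt _ hlt ?_
  rw [map_mul, map_pow, ha, one_pow, mul_one]; exact hxx'

/-- A member of the grandchildren set of a SELF-DUAL vertex is self-dual (two steps of the bipartite alternation). [cite: Serre1980Trees, II.1.1] [cite: BruhatTits1972, §10] -/
theorem isSelfDualLattice_of_mem_gc (hvσ : ∀ a, Valued.v (σ a) = Valued.v a) (hϖ : Valued.v ϖ = WithZero.exp (-1 : ℤ)) {γ : unitaryGroupOfForm σ ((StdForm.antidiagonal 3).over K)}
    (GC : {M : Submodule 𝒪[K] (Fin 3 → K) // IsVertex σ ϖ ((StdForm.antidiagonal 3).over K) M} → Set {M : Submodule 𝒪[K] (Fin 3 → K) // IsVertex σ ϖ ((StdForm.antidiagonal 3).over K) M}) (hGC : ∀ v w, w ∈ GC v ↔ ∃ c, ((latticeGraph σ ϖ ((StdForm.antidiagonal 3).over K)).Adj v c ∧ (latticeGraph σ ϖ ((StdForm.antidiagonal 3).over K)).dist ⟨stdLattice K 3, 0, isSelfDualLattice_stdLattice_three_of_v hϖ⟩ c = (latticeGraph σ ϖ ((StdForm.antidiagonal 3).over K)).dist ⟨stdLattice K 3, 0,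 isSelfDualLattice_stdLattice_three_of_v hϖ⟩ v + 1 ∧ c ∈ {v | latticeGraphIso σ ϖ ((StdForm.antidiagonal 3).over K) γ v = v}) ∧
      ((latticeGraph σ ϖ ((StdForm.antidiagonal 3).over K)).Adj c w ∧ (latticeGraph σ ϖ ((StdForm.antidiagonal 3).over K)).dist ⟨stdLattice K 3, 0, isSelfDualLattice_stdLattice_three_of_v hϖ⟩ w = (latticeGraph σ ϖ ((StdForm.antidiagonal 3).over K)).dist ⟨stdLattice K 3, 0, isSelfDualLattice_stdLattice_three_of_v hϖ⟩ c + 1 ∧ w ∈ {v | latticeGraphIso σ ϖ ((StdForm.antidiagonal 3).over K) γ v = v})) {v w : {M : Submodule 𝒪[K] (Fin 3 → K) // IsVertex σ ϖ ((StdForm.antidiagonal 3).over K) M}} (hv : IsSelfDualLattice σ ϖ ((StdForm.antidiagonal 3).over K) v.1) (hw : w ∈ GC v) : IsSelfDualLattice σ ϖ ((StdForm.antidiagonal 3).over K) w.1 := by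
  obtain ⟨c, ⟨hvc, -, -⟩, hcw, -, -⟩ := (hGC v w).1 hw
  have hc : ¬ IsSelfDualLattice σ ϖ ((StdForm.antidiagonal 3).over K) c.1 := (isSelfDualLattice_iff_not_isSelfDualLattice_of_adj_of_v hvσ hϖ hvc).1 hv
  by_contra hw'
  exact hc ((isSelfDualLattice_iff_not_isSelfDualLattice_of_adj_of_v hvσ hϖ hcw).2 hw')

/-! ## §2 The rows `hO` and `hP` of the engine (GEN dialect) -/

/-- **`hO`: a REGULAR ODD fixed self-dual vertex (`dep = 2m+3 < D`, `rk = 2`)** has fixed grandchildren of label `(2m+2, 2)` or `(2m+1, 1, ±1)`, with `q` of the first kind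
and `C(q,2)` of each class (★ ROW-O at `c := c₁`, translated by the label calculus). [cite: Kottwitz1986, §3] [cite: Rogawski1990, §4.9 pp. 54–56] -/
theorem engineRowGen_O (hσ : ∀ x, σ (σ x) = x) (hvσ : ∀ a, Valued.v (σ a) = Valued.v a) (hσϖ : σ ϖ = -ϖ)
    (hϖ : Valued.v ϖ = WithZero.exp (-1 : ℤ)) (hres : ∀ x : K, Valued.v x ≤ 1 → Valued.v (σ x - x) < 1) (h2 : Valued.v (2 : K) = 1) [Finite 𝓀[K]]
    (hT : (latticeGraph σ ϖ ((StdForm.antidiagonal 3).over K)).IsTree)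
    {γ : unitaryGroupOfForm σ ((StdForm.antidiagonal 3).over K)} (hγ0 : γ ∈ unitaryInt σ ((StdForm.antidiagonal 3).over K))
    (A : GL (Fin 3) K) (s : Fin 3 → K) (hs1 : s 1 = 1)
    (hγA : ((γ : GL (Fin 3) K) : Matrix (Fin 3) (Fin 3) K) = (A : Matrix (Fin 3) (Fin 3) K) * Matrix.diagonal s * ((A⁻¹ : GL (Fin 3) K) : Matrix (Fin 3) (Fin 3) K))
    {D : ℕ} (heD : ∀ i, Valued.v (s i - 1) ≤ Valued.v ϖ ^ D)
    (c₁ : K) (hc₁ : Valued.v c₁ = 1)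
    (B : ℕ) (dep rk : {M : Submodule 𝒪[K] (Fin 3 → K) // IsVertex σ ϖ ((StdForm.antidiagonal 3).over K) M} → ℕ) (cl : {M : Submodule 𝒪[K] (Fin 3 → K) // IsVertex σ ϖ ((StdForm.antidiagonal 3).over K) M} → ℤ)
    (hdep : ∀ w : {M : Submodule 𝒪[K] (Fin 3 → K) // IsVertex σ ϖ ((StdForm.antidiagonal 3).over K) M}, latticeGraphIso σ ϖ ((StdForm.antidiagonal 3).over K) γ w = w → ∀ e, e ≤ dep w ↔ e ≤ B ∧ w.1.map ((Matrix.toLin' (((γ : GL (Fin 3) K) : Matrix (Fin 3) (Fin 3) K) - 1)).restrictScalars 𝒪[K]) ≤ scaleLattice (ϖ ^ e) w.1)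
    (hrk : ∀ w : {M : Submodule 𝒪[K] (Fin 3 → K) // IsVertex σ ϖ ((StdForm.antidiagonal 3).over K) M}, rk w = if w.1.map ((Matrix.toLin' ((((γ : GL (Fin 3) K) : Matrix (Fin 3) (Fin 3) K) - 1) ^ 2)).restrictScalars 𝒪[K]) ≤ scaleLattice (ϖ ^ (2 * dep w + 1)) w.1 then 1 else 2)
    (hcl : ∀ w : {M : Submodule 𝒪[K] (Fin 3 → K) // IsVertex σ ϖ ((StdForm.antidiagonal 3).over K) M}, cl w = if (∃ y ∈ w.1, ∃ a : K, Valued.v a = 1 ∧ Valued.v ((ϖ ^ (dep w))⁻¹ * pairing σ ((StdForm.antidiagonal 3).over K) y ((((γ : GL (Fin 3) K) : Matrix (Fin 3) (Fin 3) K) - 1) *ᵥ y) - (c₁) * a ^ 2) < 1) then (1 : ℤ) else -1)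
    (hBD : D ≤ B)
    (GC : {M : Submodule 𝒪[K] (Fin 3 → K) // IsVertex σ ϖ ((StdForm.antidiagonal 3).over K) M} → Set {M : Submodule 𝒪[K] (Fin 3 → K) // IsVertex σ ϖ ((StdForm.antidiagonal 3).over K) M}) (hGC : ∀ v w, w ∈ GC v ↔ ∃ c, ((latticeGraph σ ϖ ((StdForm.antidiagonal 3).over K)).Adj v c ∧ (latticeGraph σ ϖ ((StdForm.antidiagonal 3).over K)).dist ⟨stdLattice K 3, 0, isSelfDualLattice_stdLattice_three_of_v hϖ⟩ c = (latticeGraph σ ϖ ((StdForm.antidiagonal 3).over K)).dist ⟨stdLattice K 3, 0, isSelfDualLattice_stdLattice_three_of_v hϖ⟩ v + 1 ∧ c ∈ {v | latticeGraphIso σ ϖ ((StdForm.antidiagonal 3).over K) γ v = v}) ∧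
      ((latticeGraph σ ϖ ((StdForm.antidiagonal 3).over K)).Adj c w ∧ (latticeGraph σ ϖ ((StdForm.antidiagonal 3).over K)).dist ⟨stdLattice K 3, 0, isSelfDualLattice_stdLattice_three_of_v hϖ⟩ w = (latticeGraph σ ϖ ((StdForm.antidiagonal 3).over K)).dist ⟨stdLattice K 3, 0, isSelfDualLattice_stdLattice_three_of_v hϖ⟩ c + 1 ∧ w ∈ {v | latticeGraphIso σ ϖ ((StdForm.antidiagonal 3).over K) γ v = v}))
    (q : ℕ) (hq : q = Nat.card 𝓀[K])
    (horient : ∀ v : {M : Submodule 𝒪[K] (Fin 3 → K) // IsVertex σ ϖ ((StdForm.antidiagonal 3).over K) M}, IsSelfDualLattice σ ϖ ((StdForm.antidiagonal 3).over K) v.1 → v ≠ ⟨stdLattice K 3, 0, isSelfDualLattice_stdLattice_three_of_v hϖ⟩ → latticeGraphIso σ ϖ ((StdForm.antidiagonal 3).over K) γ v = v → dep v < D →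
      ∃ p g : {M : Submodule 𝒪[K] (Fin 3 → K) // IsVertex σ ϖ ((StdForm.antidiagonal 3).over K) M}, (latticeGraph σ ϖ ((StdForm.antidiagonal 3).over K)).Adj v p ∧ (latticeGraph σ ϖ ((StdForm.antidiagonal 3).over K)).dist ⟨stdLattice K 3, 0, isSelfDualLattice_stdLattice_three_of_v hϖ⟩ p + 1 = (latticeGraph σ ϖ ((StdForm.antidiagonal 3).over K)).dist ⟨stdLattice K 3, 0, isSelfDualLattice_stdLattice_three_of_v hϖ⟩ v ∧ (latticeGraph σ ϖ ((StdForm.antidiagonal 3).over K)).Adj p g ∧ g ≠ v ∧ g.1.map ((Matrix.toLin' (((γ : GL (Fin 3) K) : Matrix (Fin 3) (Fin 3) K) - 1)).restrictScalars 𝒪[K]) ≤ scaleLattice (ϖ ^ dep v) g.1)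
    (v : {M : Submodule 𝒪[K] (Fin 3 → K) // IsVertex σ ϖ ((StdForm.antidiagonal 3).over K) M}) (hvF : v ∈ {v : {M : Submodule 𝒪[K] (Fin 3 → K) // IsVertex σ ϖ ((StdForm.antidiagonal 3).over K) M} | latticeGraphIso σ ϖ ((StdForm.antidiagonal 3).over K) γ v = v}) (hv : IsSelfDualLattice σ ϖ ((StdForm.antidiagonal 3).over K) v.1) (hvr : v ≠ ⟨stdLattice K 3, 0, isSelfDualLattice_stdLattice_three_of_v hϖ⟩) (hvD : dep v < D) (m : ℕ) (hdm : dep v = 2 * m + 3) (hrk2 : rk v = 2) :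
    (∀ w ∈ GC v, (dep w = 2 * m + 2 ∧ rk w = 2) ∨ (dep w = 2 * m + 1 ∧ rk w = 1 ∧ (cl w = 1 ∨ cl w = -1))) ∧
      {w | w ∈ GC v ∧ dep w = 2 * m + 2}.ncard = q ∧ {w | w ∈ GC v ∧ dep w = 2 * m + 1 ∧ cl w = 1}.ncard = q.choose 2 ∧
        {w | w ∈ GC v ∧ dep w = 2 * m + 1 ∧ cl w = -1}.ncard = q.choose 2 := by
  have hfix : latticeGraphIso σ ϖ ((StdForm.antidiagonal 3).over K) γ v = v := hvF
  obtain ⟨p, g, hp, hpin, hg, hgv, hup⟩ := horient v hv hvr hfix hvD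
  rw [hdm] at hup hvD
  have hlev := lev_pow_of_le_dep hdep hfix (le_of_eq hdm.symm)
  have hlev' := not_lev_pow_of_dep_lt hdep hfix (show 2 * m + 3 + 1 ≤ B by omega) (by omega : dep v < 2 * m + 3 + 1)
  have hrk' := ((rk_eq_one_iff_of_hrk hrk v).2).1 hrk2
  rw [hdm] at hrk'
  have hnil := lev₃_of_lev_of_eigenframe_of_le hϖ hγ0 A s hs1 hγA heD v (by omega : 2 * m + 3 + 1 ≤ D) hlev
  obtain ⟨hall, hq1, hsq, hnsq⟩ := fixedGrandchildren_tokens_and_ncard_of_odd hσ hvσ hσϖ hϖ hres h2 hT hγ0 hv hvr hfix (by omega : 3 ≤ 2 * m + 3) ⟨m + 1, by ring⟩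
    hp hpin hg hgv hup hlev hlev' hrk' hnil c₁ hc₁
  simp only [show 2 * m + 3 - 1 = 2 * m + 2 from by omega, show 2 * m + 3 - 2 = 2 * m + 1 from by omega, show 2 * (2 * m + 3) - 1 = 2 * (2 * m + 2) + 1 from by omega,
    show 2 * (2 * m + 3) - 3 = 2 * (2 * m + 1) + 1 from by omega] at hall hq1 hsq hnsq
  have hGCv := gc_eq_rowSet hϖ GC hGC v
  -- label dictionary at a grandchild
  have hdict : ∀ w ∈ GC v, ((w.1.map ((Matrix.toLin' (((γ : GL (Fin 3) K) : Matrix (Fin 3) (Fin 3) K) - 1)).restrictScalars 𝒪[K]) ≤ scaleLattice (ϖ ^ (2 * m + 2)) w.1 ∧ ¬ w.1.map ((Matrix.toLin' (((γ : GL (Fin 3) K) : Matrix (Fin 3) (Fin 3) K) - 1)).restrictScalars 𝒪[K]) ≤ scaleLattice (ϖ ^ (2 * m + 3)) w.1) ↔ dep w = 2 * m + 2) ∧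
      ((w.1.map ((Matrix.toLin' (((γ : GL (Fin 3) K) : Matrix (Fin 3) (Fin 3) K) - 1)).restrictScalars 𝒪[K]) ≤ scaleLattice (ϖ ^ (2 * m + 1)) w.1 ∧ ¬ w.1.map ((Matrix.toLin' (((γ : GL (Fin 3) K) : Matrix (Fin 3) (Fin 3) K) - 1)).restrictScalars 𝒪[K]) ≤ scaleLattice (ϖ ^ (2 * m + 2)) w.1) ↔ dep w = 2 * m + 1) := by
    intro w hw
    have hwfix := fix_of_mem_gc hϖ GC hGC hw
    refine ⟨⟨fun h => dep_eq_of_lev_of_not_lev hdep hwfix (by omega) h.1 h.2, fun h => ⟨lev_pow_of_le_dep hdep hwfix (le_of_eq h.symm),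
      not_lev_pow_of_dep_lt hdep hwfix (by omega) (by omega)⟩⟩, ⟨fun h => dep_eq_of_lev_of_not_lev hdep hwfix (by omega) h.1 h.2, fun h => ⟨lev_pow_of_le_dep hdep hwfix (le_of_eq h.symm),
      not_lev_pow_of_dep_lt hdep hwfix (by omega) (by omega)⟩⟩⟩
  refine ⟨fun w hw => ?_, ?_, ?_, ?_⟩
  · have hw' := hw
    rw [hGCv] at hw'
    rcases hall w hw' with ⟨h1, h2', h3⟩ | ⟨h1, h2', h3⟩
    · have hdw : dep w = 2 * m + 2 := ((hdict w hw).1).1 ⟨h1, h2'⟩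
      exact Or.inl ⟨hdw, ((rk_eq_one_iff_of_hrk hrk w).2).2 (by rw [hdw]; exact h3)⟩
    · have hdw : dep w = 2 * m + 1 := ((hdict w hw).2).1 ⟨h1, h2'⟩
      exact Or.inr ⟨hdw, ((rk_eq_one_iff_of_hrk hrk w).1).2 (by rw [hdw]; exact h3), (cl_eq_one_iff_of_hcl hcl w).2.2⟩
  · rw [hq, ← hq1]
    congr 1
    ext w
    simp only [Set.mem_setOf_eq]
    constructor
    · rintro ⟨hw, hdw⟩; exact ⟨(hGC v w).1 hw, ((hdict w hw).1).2 hdw⟩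
    · rintro ⟨hw', ht⟩
      have hw : w ∈ GC v := (hGC v w).2 hw'
      exact ⟨hw, ((hdict w hw).1).1 ht⟩
  · rw [hq, ← hsq]
    congr 1
    ext w
    simp only [Set.mem_setOf_eq]
    constructor
    · rintro ⟨hw, hdw, hcw⟩
      refine ⟨(hGC v w).1 hw, ((hdict w hw).2).2 hdw, ?_⟩
      have h := ((cl_eq_one_iff_of_hcl hcl w).1).1 hcw
      rwa [hdw] at h
    · rintro ⟨hw', ht, hcls⟩
      have hw : w ∈ GC v := (hGC v w).2 hw'
      have hdw := ((hdict w hw).2).1 ht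
      exact ⟨hw, hdw, ((cl_eq_one_iff_of_hcl hcl w).1).2 (by rw [hdw]; exact hcls)⟩
  · rw [hq, ← hnsq]
    congr 1
    ext w
    simp only [Set.mem_setOf_eq]
    constructor
    · rintro ⟨hw, hdw, hcw⟩
      refine ⟨(hGC v w).1 hw, ((hdict w hw).2).2 hdw, ?_⟩
      have h := ((cl_eq_one_iff_of_hcl hcl w).2.1).1 hcw
      rwa [hdw] at h
    · rintro ⟨hw', ht, hcls⟩
      have hw : w ∈ GC v := (hGC v w).2 hw'
      have hdw := ((hdict w hw).2).1 ht
      exact ⟨hw, hdw, ((cl_eq_one_iff_of_hcl hcl w).2.1).2 (by rw [hdw]; exact hcls)⟩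

/-- **`hP`: a RANK-ONE ODD fixed self-dual vertex (`dep = 2m+3 < D`, `rk = 1`, `cl = c`)** has `q²` fixed grandchildren, all of label `(2m+1, 1, sgn·c)` with
`sgn = χ(−1)` (★ ROW-P at the class constant `c₁` or `c₁ε` chosen by ★ ROW-1C at `v`, the class dictionary `hsgnDict`, and ★ ROW-1C at the grandchild).
[cite: Kottwitz1986, §3] [cite: Rogawski1990, §4.9 pp. 54–56] -/
theorem engineRowGen_P (hσ : ∀ x, σ (σ x) = x) (hvσ : ∀ a, Valued.v (σ a) = Valued.v a) (hσϖ : σ ϖ = -ϖ)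
    (hϖ : Valued.v ϖ = WithZero.exp (-1 : ℤ)) (hres : ∀ x : K, Valued.v x ≤ 1 → Valued.v (σ x - x) < 1) (h2 : Valued.v (2 : K) = 1) [Finite 𝓀[K]]
    (hT : (latticeGraph σ ϖ ((StdForm.antidiagonal 3).over K)).IsTree)
    {γ : unitaryGroupOfForm σ ((StdForm.antidiagonal 3).over K)} (hγ0 : γ ∈ unitaryInt σ ((StdForm.antidiagonal 3).over K))
    (A : GL (Fin 3) K) (s : Fin 3 → K) (hs1 : s 1 = 1)
    (hγA : ((γ : GL (Fin 3) K) : Matrix (Fin 3) (Fin 3) K) = (A : Matrix (Fin 3) (Fin 3) K) * Matrix.diagonal s * ((A⁻¹ : GL (Fin 3) K) : Matrix (Fin 3) (Fin 3) K))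
    {D : ℕ} (heD : ∀ i, Valued.v (s i - 1) ≤ Valued.v ϖ ^ D)
    (c₁ ε : K) (hc₁ : Valued.v c₁ = 1) (hεv : Valued.v ε = 1) (hε : ∀ z : K, Valued.v z ≤ 1 → Valued.v (z ^ 2 - ε) = 1)
    (B : ℕ) (dep rk : {M : Submodule 𝒪[K] (Fin 3 → K) // IsVertex σ ϖ ((StdForm.antidiagonal 3).over K) M} → ℕ) (cl : {M : Submodule 𝒪[K] (Fin 3 → K) // IsVertex σ ϖ ((StdForm.antidiagonal 3).over K) M} → ℤ)
    (hdep : ∀ w : {M : Submodule 𝒪[K] (Fin 3 → K) // IsVertex σ ϖ ((StdForm.antidiagonal 3).over K) M}, latticeGraphIso σ ϖ ((StdForm.antidiagonal 3).over K) γ w = w → ∀ e, e ≤ dep w ↔ e ≤ B ∧ w.1.map ((Matrix.toLin' (((γ : GL (Fin 3) K) : Matrix (Fin 3) (Fin 3) K) - 1)).restrictScalars 𝒪[K]) ≤ scaleLattice (ϖ ^ e) w.1)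
    (hrk : ∀ w : {M : Submodule 𝒪[K] (Fin 3 → K) // IsVertex σ ϖ ((StdForm.antidiagonal 3).over K) M}, rk w = if w.1.map ((Matrix.toLin' ((((γ : GL (Fin 3) K) : Matrix (Fin 3) (Fin 3) K) - 1) ^ 2)).restrictScalars 𝒪[K]) ≤ scaleLattice (ϖ ^ (2 * dep w + 1)) w.1 then 1 else 2)
    (hcl : ∀ w : {M : Submodule 𝒪[K] (Fin 3 → K) // IsVertex σ ϖ ((StdForm.antidiagonal 3).over K) M}, cl w = if (∃ y ∈ w.1, ∃ a : K, Valued.v a = 1 ∧ Valued.v ((ϖ ^ (dep w))⁻¹ * pairing σ ((StdForm.antidiagonal 3).over K) y ((((γ : GL (Fin 3) K) : Matrix (Fin 3) (Fin 3) K) - 1) *ᵥ y) - (c₁) * a ^ 2) < 1) then (1 : ℤ) else -1)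
    (hBD : D ≤ B)
    (GC : {M : Submodule 𝒪[K] (Fin 3 → K) // IsVertex σ ϖ ((StdForm.antidiagonal 3).over K) M} → Set {M : Submodule 𝒪[K] (Fin 3 → K) // IsVertex σ ϖ ((StdForm.antidiagonal 3).over K) M}) (hGC : ∀ v w, w ∈ GC v ↔ ∃ c, ((latticeGraph σ ϖ ((StdForm.antidiagonal 3).over K)).Adj v c ∧ (latticeGraph σ ϖ ((StdForm.antidiagonal 3).over K)).dist ⟨stdLattice K 3, 0, isSelfDualLattice_stdLattice_three_of_v hϖ⟩ c = (latticeGraph σ ϖ ((StdForm.antidiagonal 3).over K)).dist ⟨stdLattice K 3, 0, isSelfDualLattice_stdLattice_three_of_v hϖ⟩ v + 1 ∧ c ∈ {v | latticeGraphIso σ ϖ ((StdForm.antidiagonal 3).over K) γ v = v}) ∧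
      ((latticeGraph σ ϖ ((StdForm.antidiagonal 3).over K)).Adj c w ∧ (latticeGraph σ ϖ ((StdForm.antidiagonal 3).over K)).dist ⟨stdLattice K 3, 0, isSelfDualLattice_stdLattice_three_of_v hϖ⟩ w = (latticeGraph σ ϖ ((StdForm.antidiagonal 3).over K)).dist ⟨stdLattice K 3, 0, isSelfDualLattice_stdLattice_three_of_v hϖ⟩ c + 1 ∧ w ∈ {v | latticeGraphIso σ ϖ ((StdForm.antidiagonal 3).over K) γ v = v}))
    (q : ℕ) (hq : q = Nat.card 𝓀[K]) (sgn : ℤ) (hsgn : sgn = if IsSquare (-1 : 𝓀[K]) then 1 else -1)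
    (horient : ∀ v : {M : Submodule 𝒪[K] (Fin 3 → K) // IsVertex σ ϖ ((StdForm.antidiagonal 3).over K) M}, IsSelfDualLattice σ ϖ ((StdForm.antidiagonal 3).over K) v.1 → v ≠ ⟨stdLattice K 3, 0, isSelfDualLattice_stdLattice_three_of_v hϖ⟩ → latticeGraphIso σ ϖ ((StdForm.antidiagonal 3).over K) γ v = v → dep v < D →
      ∃ p g : {M : Submodule 𝒪[K] (Fin 3 → K) // IsVertex σ ϖ ((StdForm.antidiagonal 3).over K) M}, (latticeGraph σ ϖ ((StdForm.antidiagonal 3).over K)).Adj v p ∧ (latticeGraph σ ϖ ((StdForm.antidiagonal 3).over K)).dist ⟨stdLattice K 3, 0, isSelfDualLattice_stdLattice_three_of_v hϖ⟩ p + 1 = (latticeGraph σ ϖ ((StdForm.antidiagonal 3).over K)).dist ⟨stdLattice K 3, 0, isSelfDualLattice_stdLattice_three_of_v hϖ⟩ v ∧ (latticeGraph σ ϖ ((StdForm.antidiagonal 3).over K)).Adj p g ∧ g ≠ v ∧ g.1.map ((Matrix.toLin' (((γ : GL (Fin 3) K) : Matrix (Fin 3) (Fin 3) K) - 1)).restrictScalars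 𝒪[K]) ≤ scaleLattice (ϖ ^ dep v) g.1)
    (hsgnDict : ∀ c : K, Valued.v c = 1 →
      (IsSquare (-1 : 𝓀[K]) → ∃ z : K, Valued.v z = 1 ∧ Valued.v (-c - c * z ^ 2) < 1) ∧
      (¬ IsSquare (-1 : 𝓀[K]) → ∃ z : K, Valued.v z = 1 ∧ Valued.v (-c - c * ε * z ^ 2) < 1) ∧
      (¬ IsSquare (-1 : 𝓀[K]) → ∃ z : K, Valued.v z = 1 ∧ Valued.v (-(c * ε) - c * z ^ 2) < 1))
    (v : {M : Submodule 𝒪[K] (Fin 3 → K) // IsVertex σ ϖ ((StdForm.antidiagonal 3).over K) M}) (hvF : v ∈ {v : {M : Submodule 𝒪[K] (Fin 3 → K) // IsVertex σ ϖ ((StdForm.antidiagonal 3).over K) M} | latticeGraphIso σ ϖ ((StdForm.antidiagonal 3).over K) γ v = v}) (hv : IsSelfDualLattice σ ϖ ((StdForm.antidiagonal 3).over K) v.1) (hvr : v ≠ ⟨stdLattice K 3, 0, isSelfDualLattice_stdLattice_three_of_v hϖ⟩) (hvD : dep v < D) (m : ℕ) (c : ℤ) (hdm : dep v = 2 * m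 + 3) (hrk1 : rk v = 1)
    (hclv : cl v = c) :
    (∀ w ∈ GC v, dep w = 2 * m + 1 ∧ rk w = 1 ∧ cl w = sgn * c) ∧ (GC v).ncard = q ^ 2 := by
  have hfix : latticeGraphIso σ ϖ ((StdForm.antidiagonal 3).over K) γ v = v := hvF
  obtain ⟨p, g, hp, hpin, hg, hgv, hup⟩ := horient v hv hvr hfix hvD
  rw [hdm] at hup hvD
  have hlev := lev_pow_of_le_dep hdep hfix (le_of_eq hdm.symm)
  have hlev' := not_lev_pow_of_dep_lt hdep hfix (show 2 * m + 3 + 1 ≤ B by omega) (by omega : dep v < 2 * m + 3 + 1)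
  have hrk' := ((rk_eq_one_iff_of_hrk hrk v).1).1 hrk1
  rw [hdm] at hrk'
  have hnil := lev₃_of_lev_of_eigenframe_of_le hϖ hγ0 A s hs1 hγA heD v (by omega : 2 * m + 3 + 1 ≤ D) hlev
  have hc₁ε : Valued.v (c₁ * ε) = 1 := by rw [map_mul, hc₁, hεv, mul_one]
  have hGCv := gc_eq_rowSet hϖ GC hGC v
  -- the class constant at `v`: `c' ∈ {c₁, c₁ε}` with `CLS[v](2m+3)(c')`, read off `cl v`
  have hxor := class_xor_class_mul_of_selfDual_rankOne hσ hvσ hσϖ hϖ hres h2 γ hv (by omega : 1 ≤ 2 * m + 3) hlev hlev' hrk' c₁ ε hc₁ hεv hε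
  have hclv' := cl_eq_one_iff_of_hcl hcl v
  rw [hdm] at hclv'
  -- generic step: ROW-P at a class constant `c'` and the resulting grandchild data
  have hstep : ∀ c' : K, Valued.v c' = 1 → (∃ y ∈ v.1, ∃ a : K, Valued.v a = 1 ∧ Valued.v ((ϖ ^ (2 * m + 3))⁻¹ * pairing σ ((StdForm.antidiagonal 3).over K) y ((((γ : GL (Fin 3) K) : Matrix (Fin 3) (Fin 3) K) - 1) *ᵥ y) - (c') * a ^ 2) < 1) →
      (∀ w ∈ GC v, dep w = 2 * m + 1 ∧ rk w = 1 ∧ (∃ y ∈ w.1, ∃ a : K, Valued.v a = 1 ∧ Valued.v ((ϖ ^ (2 * m + 1))⁻¹ * pairing σ ((StdForm.antidiagonal 3).over K) y ((((γ : GL (Fin 3) K) : Matrix (Fin 3) (Fin 3) K) - 1) *ᵥ y) - (-c') * a ^ 2) < 1) ∧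
        (((∃ y ∈ w.1, ∃ a : K, Valued.v a = 1 ∧ Valued.v ((ϖ ^ (2 * m + 1))⁻¹ * pairing σ ((StdForm.antidiagonal 3).over K) y ((((γ : GL (Fin 3) K) : Matrix (Fin 3) (Fin 3) K) - 1) *ᵥ y) - (c₁) * a ^ 2) < 1) ∨ (∃ y ∈ w.1, ∃ a : K, Valued.v a = 1 ∧ Valued.v ((ϖ ^ (2 * m + 1))⁻¹ * pairing σ ((StdForm.antidiagonal 3).over K) y ((((γ : GL (Fin 3) K) : Matrix (Fin 3) (Fin 3) K) - 1) *ᵥ y) - (c₁ * ε) * a ^ 2) < 1)) ∧ ¬ ((∃ y ∈ w.1, ∃ a : K, Valued.v a = 1 ∧ Valued.v ((ϖ ^ (2 * m + 1))⁻¹ * pairing σ ((StdForm.antidiagonal 3).over K) y ((((γ : GL (Fin 3) K) : Matrix (Fin 3) (Fin 3) K) - 1) *ᵥ y) - (c₁) * a ^ 2) < 1) ∧ (∃ y ∈ w.1, ∃ a : K, Valued.v a = 1 ∧ Valued.v ((ϖ ^ (2 * m + 1))⁻¹ * pairing σ ((StdForm.antidiagonal 3).over K) y ((((γ : GL (Fin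 3) K) : Matrix (Fin 3) (Fin 3) K) - 1) *ᵥ y) - (c₁ * ε) * a ^ 2) < 1)))) ∧
      (GC v).ncard = q ^ 2 := by
    intro c' hc' hcls
    obtain ⟨hall, hcard⟩ := fixedGrandchildren_tokens_and_ncard_of_rankOne hσ hvσ hσϖ hϖ hres h2 hT hγ0 hv hvr hfix (by omega : 3 ≤ 2 * m + 3) ⟨m + 1, by ring⟩
      hp hpin hg hgv hup hlev hlev' hrk' hnil c' hc' hcls
    simp only [show 2 * m + 3 - 1 = 2 * m + 2 from by omega, show 2 * m + 3 - 2 = 2 * m + 1 from by omega,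
      show 2 * (2 * m + 3) - 3 = 2 * (2 * m + 1) + 1 from by omega] at hall
    refine ⟨fun w hw => ?_, by rw [hGCv, hq]; exact hcard⟩
    have hwfix := fix_of_mem_gc hϖ GC hGC hw
    have hwsd := isSelfDualLattice_of_mem_gc hvσ hϖ GC hGC hv hw
    have hw' := hw
    rw [hGCv] at hw'
    obtain ⟨h1, h2', h3, h4⟩ := hall w hw'
    have hdw : dep w = 2 * m + 1 := dep_eq_of_lev_of_not_lev hdep hwfix (by omega) h1 h2'
    exact ⟨hdw, ((rk_eq_one_iff_of_hrk hrk w).1).2 (by rw [hdw]; exact h3), h4,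
      class_xor_class_mul_of_selfDual_rankOne hσ hvσ hσϖ hϖ hres h2 γ hwsd (by omega : 1 ≤ 2 * m + 1) h1 h2' h3 c₁ ε hc₁ hεv hε⟩
  -- the class dictionary at a grandchild: from `CLS(−c')` to `cl w`
  have hclw : ∀ w : {M : Submodule 𝒪[K] (Fin 3 → K) // IsVertex σ ϖ ((StdForm.antidiagonal 3).over K) M}, dep w = 2 * m + 1 → (cl w = 1 ↔ (∃ y ∈ w.1, ∃ a : K, Valued.v a = 1 ∧ Valued.v ((ϖ ^ (2 * m + 1))⁻¹ * pairing σ ((StdForm.antidiagonal 3).over K) y ((((γ : GL (Fin 3) K) : Matrix (Fin 3) (Fin 3) K) - 1) *ᵥ y) - (c₁) * a ^ 2) < 1)) ∧ (cl w = -1 ↔ ¬ (∃ y ∈ w.1, ∃ a : K, Valued.v a = 1 ∧ Valued.v ((ϖ ^ (2 * m + 1))⁻¹ * pairing σ ((StdForm.antidiagonal 3).over K) y ((((γ : GL (Fin 3) K) : Matrix (Fin 3) (Fin 3) K) - 1) *ᵥ y) - (c₁) * a ^ 2) < 1)) := by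
    intro w hdw
    have h := cl_eq_one_iff_of_hcl hcl w
    rw [hdw] at h
    exact ⟨h.1, h.2.1⟩
  rcases (cl_eq_one_iff_of_hcl hcl v).2.2 with hcv1 | hcvm1
  · -- `cl v = 1`: class constant `c₁`
    have hc1 : c = 1 := by rw [← hclv, hcv1]
    subst hc1
    obtain ⟨hall, hcard⟩ := hstep c₁ hc₁ ((hclv'.1).1 hcv1)
    refine ⟨fun w hw => ?_, hcard⟩
    obtain ⟨hdw, hrkw, hneg, hx, hnx⟩ := hall w hw
    refine ⟨hdw, hrkw, ?_⟩
    by_cases hsq : IsSquare (-1 : 𝓀[K])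
    · rw [hsgn, if_pos hsq, mul_one]
      obtain ⟨z, hz, hzz⟩ := (hsgnDict c₁ hc₁).1 hsq
      exact ((hclw w hdw).1).2 (cls_of_cls_of_congr w (2 * m + 1) hz hzz hneg)
    · rw [hsgn, if_neg hsq, mul_one]
      obtain ⟨z, hz, hzz⟩ := (hsgnDict c₁ hc₁).2.1 hsq
      have hε' : (∃ y ∈ w.1, ∃ a : K, Valued.v a = 1 ∧ Valued.v ((ϖ ^ (2 * m + 1))⁻¹ * pairing σ ((StdForm.antidiagonal 3).over K) y ((((γ : GL (Fin 3) K) : Matrix (Fin 3) (Fin 3) K) - 1) *ᵥ y) - (c₁ * ε) * a ^ 2) < 1) := cls_of_cls_of_congr w (2 * m + 1) hz hzz hneg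
      exact ((hclw w hdw).2).2 fun h1 => hnx ⟨h1, hε'⟩
  · -- `cl v = −1`: class constant `c₁ε`
    have hc1 : c = -1 := by rw [← hclv, hcvm1]
    subst hc1
    have hncls : ¬ (∃ y ∈ v.1, ∃ a : K, Valued.v a = 1 ∧ Valued.v ((ϖ ^ (2 * m + 3))⁻¹ * pairing σ ((StdForm.antidiagonal 3).over K) y ((((γ : GL (Fin 3) K) : Matrix (Fin 3) (Fin 3) K) - 1) *ᵥ y) - (c₁) * a ^ 2) < 1) := (hclv'.2.1).1 hcvm1
    have hclsε : (∃ y ∈ v.1, ∃ a : K, Valued.v a = 1 ∧ Valued.v ((ϖ ^ (2 * m + 3))⁻¹ * pairing σ ((StdForm.antidiagonal 3).over K) y ((((γ : GL (Fin 3) K) : Matrix (Fin 3) (Fin 3) K) - 1) *ᵥ y) - (c₁ * ε) * a ^ 2) < 1) := hxor.1.resolve_left hncls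
    obtain ⟨hall, hcard⟩ := hstep (c₁ * ε) hc₁ε hclsε
    refine ⟨fun w hw => ?_, hcard⟩
    obtain ⟨hdw, hrkw, hneg, hx, hnx⟩ := hall w hw
    refine ⟨hdw, hrkw, ?_⟩
    by_cases hsq : IsSquare (-1 : 𝓀[K])
    · rw [hsgn, if_pos hsq, one_mul]
      obtain ⟨z, hz, hzz⟩ := (hsgnDict (c₁ * ε) hc₁ε).1 hsq
      have hε' : (∃ y ∈ w.1, ∃ a : K, Valued.v a = 1 ∧ Valued.v ((ϖ ^ (2 * m + 1))⁻¹ * pairing σ ((StdForm.antidiagonal 3).over K) y ((((γ : GL (Fin 3) K) : Matrix (Fin 3) (Fin 3) K) - 1) *ᵥ y) - (c₁ * ε) * a ^ 2) < 1) := cls_of_cls_of_congr w (2 * m + 1) hz hzz hneg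
      exact ((hclw w hdw).2).2 fun h1 => hnx ⟨h1, hε'⟩
    · rw [hsgn, if_neg hsq, show (-1 : ℤ) * -1 = 1 by norm_num]
      obtain ⟨z, hz, hzz⟩ := (hsgnDict c₁ hc₁).2.2 hsq
      exact ((hclw w hdw).1).2 (cls_of_cls_of_congr w (2 * m + 1) hz hzz hneg)

/-! ## §3 The head: L3 `engineRows_of_rows` (junction skeleton v10 :627, VERBATIM) -/

/-- **L3 `engineRows_of_rows` (junction skeleton v10 :627, the pen's text VERBATIM; GEN, depth-capped)**: the engine's local-law binders `hodd hB hC hR hE hO hP` for the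
abstract labels `dep rk cl` (characterised by `hdep hrk hcl`, cap `B ≥ D`) at every fixed self-dual `v ≠ r₀` with `dep v < D`, where `γ = A·diag(s)·A⁻¹`, `s 1 = 1`,
`|s i − 1| ≤ |ϖ|^D` — by the seven rows `engineRowGen_{odd,B,C,R,E,O,P}` (★ I, ★ hB + ★ NO-TV, ★ ROW-C∕R∕E∕O∕P, ★ ROW-N, ★ ROW-1C, the orientation `horient`, the sign
dictionary `hsgnDict`).  Equilateral: `D = N`; isoceles: `D = d₀`. [cite: Kottwitz1986, §3] [cite: Rogawski1990, §4.9 pp. 54–56] [cite: BruhatTits1972, §10] -/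
theorem engineRows_of_rows (hσ : ∀ x, σ (σ x) = x) (hvσ : ∀ a, Valued.v (σ a) = Valued.v a) (hσϖ : σ ϖ = -ϖ)
    (hϖ : Valued.v ϖ = WithZero.exp (-1 : ℤ)) (hres : ∀ x : K, Valued.v x ≤ 1 → Valued.v (σ x - x) < 1) (h2 : Valued.v (2 : K) = 1) [Finite 𝓀[K]]
    (hT : (latticeGraph σ ϖ ((StdForm.antidiagonal 3).over K)).IsTree)
    {γ : unitaryGroupOfForm σ ((StdForm.antidiagonal 3).over K)} (hγ0 : γ ∈ unitaryInt σ ((StdForm.antidiagonal 3).over K))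
    (A : GL (Fin 3) K) (_hA : IsIntMatrix (A : Matrix (Fin 3) (Fin 3) K)) (_hA' : IsIntMatrix ((A⁻¹ : GL (Fin 3) K) : Matrix (Fin 3) (Fin 3) K))
    (s : Fin 3 → K) (hs1 : s 1 = 1)
    (hγA : ((γ : GL (Fin 3) K) : Matrix (Fin 3) (Fin 3) K) = (A : Matrix (Fin 3) (Fin 3) K) * Matrix.diagonal s * ((A⁻¹ : GL (Fin 3) K) : Matrix (Fin 3) (Fin 3) K))
    (D : ℕ) (_hD2 : 2 ≤ D) (heD : ∀ i, Valued.v (s i - 1) ≤ Valued.v ϖ ^ D)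
    (c₁ ε : K) (hc₁ : Valued.v c₁ = 1) (hεv : Valued.v ε = 1) (hε : ∀ z : K, Valued.v z ≤ 1 → Valued.v (z ^ 2 - ε) = 1)
    (B : ℕ) (dep rk : {M : Submodule 𝒪[K] (Fin 3 → K) // IsVertex σ ϖ ((StdForm.antidiagonal 3).over K) M} → ℕ) (cl : {M : Submodule 𝒪[K] (Fin 3 → K) // IsVertex σ ϖ ((StdForm.antidiagonal 3).over K) M} → ℤ)
    (hdep : ∀ w : {M : Submodule 𝒪[K] (Fin 3 → K) // IsVertex σ ϖ ((StdForm.antidiagonal 3).over K) M}, latticeGraphIso σ ϖ ((StdForm.antidiagonal 3).over K) γ w = w → ∀ e, e ≤ dep w ↔ e ≤ B ∧ w.1.map ((Matrix.toLin' (((γ : GL (Fin 3) K) : Matrix (Fin 3) (Fin 3) K) - 1)).restrictScalars 𝒪[K]) ≤ scaleLattice (ϖ ^ e) w.1)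
    (hrk : ∀ w : {M : Submodule 𝒪[K] (Fin 3 → K) // IsVertex σ ϖ ((StdForm.antidiagonal 3).over K) M}, rk w = if w.1.map ((Matrix.toLin' ((((γ : GL (Fin 3) K) : Matrix (Fin 3) (Fin 3) K) - 1) ^ 2)).restrictScalars 𝒪[K]) ≤ scaleLattice (ϖ ^ (2 * dep w + 1)) w.1 then 1 else 2)
    (hcl : ∀ w : {M : Submodule 𝒪[K] (Fin 3 → K) // IsVertex σ ϖ ((StdForm.antidiagonal 3).over K) M}, cl w = if (∃ y ∈ w.1, ∃ a : K, Valued.v a = 1 ∧ Valued.v ((ϖ ^ (dep w))⁻¹ * pairing σ ((StdForm.antidiagonal 3).over K) y ((((γ : GL (Fin 3) K) : Matrix (Fin 3) (Fin 3) K) - 1) *ᵥ y) - (c₁) * a ^ 2) < 1) then (1 : ℤ) else -1)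
    (hBD : D ≤ B)
    (GC : {M : Submodule 𝒪[K] (Fin 3 → K) // IsVertex σ ϖ ((StdForm.antidiagonal 3).over K) M} → Set {M : Submodule 𝒪[K] (Fin 3 → K) // IsVertex σ ϖ ((StdForm.antidiagonal 3).over K) M}) (hGC : ∀ v w, w ∈ GC v ↔ ∃ c, ((latticeGraph σ ϖ ((StdForm.antidiagonal 3).over K)).Adj v c ∧ (latticeGraph σ ϖ ((StdForm.antidiagonal 3).over K)).dist ⟨stdLattice K 3, 0, isSelfDualLattice_stdLattice_three_of_v hϖ⟩ c = (latticeGraph σ ϖ ((StdForm.antidiagonal 3).over K)).dist ⟨stdLattice K 3, 0, isSelfDualLattice_stdLattice_three_of_v hϖ⟩ v + 1 ∧ c ∈ {v | latticeGraphIso σ ϖ ((StdForm.antidiagonal 3).over K) γ v = v}) ∧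
      ((latticeGraph σ ϖ ((StdForm.antidiagonal 3).over K)).Adj c w ∧ (latticeGraph σ ϖ ((StdForm.antidiagonal 3).over K)).dist ⟨stdLattice K 3, 0, isSelfDualLattice_stdLattice_three_of_v hϖ⟩ w = (latticeGraph σ ϖ ((StdForm.antidiagonal 3).over K)).dist ⟨stdLattice K 3, 0, isSelfDualLattice_stdLattice_three_of_v hϖ⟩ c + 1 ∧ w ∈ {v | latticeGraphIso σ ϖ ((StdForm.antidiagonal 3).over K) γ v = v}))
    (q : ℕ) (hq : q = Nat.card 𝓀[K]) (sgn : ℤ) (hsgn : sgn = if IsSquare (-1 : 𝓀[K]) then 1 else -1)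
    (horient : ∀ v : {M : Submodule 𝒪[K] (Fin 3 → K) // IsVertex σ ϖ ((StdForm.antidiagonal 3).over K) M}, IsSelfDualLattice σ ϖ ((StdForm.antidiagonal 3).over K) v.1 → v ≠ ⟨stdLattice K 3, 0, isSelfDualLattice_stdLattice_three_of_v hϖ⟩ → latticeGraphIso σ ϖ ((StdForm.antidiagonal 3).over K) γ v = v → dep v < D →
      ∃ p g : {M : Submodule 𝒪[K] (Fin 3 → K) // IsVertex σ ϖ ((StdForm.antidiagonal 3).over K) M}, (latticeGraph σ ϖ ((StdForm.antidiagonal 3).over K)).Adj v p ∧ (latticeGraph σ ϖ ((StdForm.antidiagonal 3).over K)).dist ⟨stdLattice K 3, 0, isSelfDualLattice_stdLattice_three_of_v hϖ⟩ p + 1 = (latticeGraph σ ϖ ((StdForm.antidiagonal 3).over K)).dist ⟨stdLattice K 3, 0, isSelfDualLattice_stdLattice_three_of_v hϖ⟩ v ∧ (latticeGraph σ ϖ ((StdForm.antidiagonal 3).over K)).Adj p g ∧ g ≠ v ∧ g.1.map ((Matrix.toLin' (((γ : GL (Fin 3) K) : Matrix (Fin 3) (Fin 3) K) - 1)).restrictScalars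 𝒪[K]) ≤ scaleLattice (ϖ ^ dep v) g.1)
    (hsgnDict : ∀ c : K, Valued.v c = 1 →
      (IsSquare (-1 : 𝓀[K]) → ∃ z : K, Valued.v z = 1 ∧ Valued.v (-c - c * z ^ 2) < 1) ∧
      (¬ IsSquare (-1 : 𝓀[K]) → ∃ z : K, Valued.v z = 1 ∧ Valued.v (-c - c * ε * z ^ 2) < 1) ∧
      (¬ IsSquare (-1 : 𝓀[K]) → ∃ z : K, Valued.v z = 1 ∧ Valued.v (-(c * ε) - c * z ^ 2) < 1)) :
    (∀ v, v ∈ {v | latticeGraphIso σ ϖ ((StdForm.antidiagonal 3).over K) γ v = v} → IsSelfDualLattice σ ϖ ((StdForm.antidiagonal 3).over K) v.1 → v ≠ ⟨stdLattice K 3, 0, isSelfDualLattice_stdLattice_three_of_v hϖ⟩ → dep v < D → 2 ≤ dep v → rk v = 1 → Odd (dep v)) ∧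
    (∀ v, v ∈ {v | latticeGraphIso σ ϖ ((StdForm.antidiagonal 3).over K) γ v = v} → IsSelfDualLattice σ ϖ ((StdForm.antidiagonal 3).over K) v.1 → v ≠ ⟨stdLattice K 3, 0, isSelfDualLattice_stdLattice_three_of_v hϖ⟩ → dep v < D → dep v = 0 → GC v = ∅) ∧
    (∀ v, v ∈ {v | latticeGraphIso σ ϖ ((StdForm.antidiagonal 3).over K) γ v = v} → IsSelfDualLattice σ ϖ ((StdForm.antidiagonal 3).over K) v.1 → v ≠ ⟨stdLattice K 3, 0, isSelfDualLattice_stdLattice_three_of_v hϖ⟩ → dep v < D → dep v = 1 → rk v = 1 → GC v = ∅) ∧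
    (∀ v, v ∈ {v | latticeGraphIso σ ϖ ((StdForm.antidiagonal 3).over K) γ v = v} → IsSelfDualLattice σ ϖ ((StdForm.antidiagonal 3).over K) v.1 → v ≠ ⟨stdLattice K 3, 0, isSelfDualLattice_stdLattice_three_of_v hϖ⟩ → dep v < D → dep v = 1 → rk v = 2 → (∀ w ∈ GC v, dep w = 0) ∧ (GC v).ncard = q) ∧
    (∀ v, v ∈ {v | latticeGraphIso σ ϖ ((StdForm.antidiagonal 3).over K) γ v = v} → IsSelfDualLattice σ ϖ ((StdForm.antidiagonal 3).over K) v.1 → v ≠ ⟨stdLattice K 3, 0, isSelfDualLattice_stdLattice_three_of_v hϖ⟩ → dep v < D → ∀ m, dep v = 2 * m + 2 → rk v = 2 → (∀ w ∈ GC v, dep w = 2 * m + 1 ∧ rk w = 2) ∧ (GC v).ncard = q ^ 2) ∧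
    (∀ v, v ∈ {v | latticeGraphIso σ ϖ ((StdForm.antidiagonal 3).over K) γ v = v} → IsSelfDualLattice σ ϖ ((StdForm.antidiagonal 3).over K) v.1 → v ≠ ⟨stdLattice K 3, 0, isSelfDualLattice_stdLattice_three_of_v hϖ⟩ → dep v < D → ∀ m, dep v = 2 * m + 3 → rk v = 2 →
      (∀ w ∈ GC v, (dep w = 2 * m + 2 ∧ rk w = 2) ∨ (dep w = 2 * m + 1 ∧ rk w = 1 ∧ (cl w = 1 ∨ cl w = -1))) ∧
        {w | w ∈ GC v ∧ dep w = 2 * m + 2}.ncard = q ∧ {w | w ∈ GC v ∧ dep w = 2 * m + 1 ∧ cl w = 1}.ncard = q.choose 2 ∧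
          {w | w ∈ GC v ∧ dep w = 2 * m + 1 ∧ cl w = -1}.ncard = q.choose 2) ∧
    (∀ v, v ∈ {v | latticeGraphIso σ ϖ ((StdForm.antidiagonal 3).over K) γ v = v} → IsSelfDualLattice σ ϖ ((StdForm.antidiagonal 3).over K) v.1 → v ≠ ⟨stdLattice K 3, 0, isSelfDualLattice_stdLattice_three_of_v hϖ⟩ → dep v < D → ∀ m (c : ℤ), dep v = 2 * m + 3 → rk v = 1 → cl v = c →
      (∀ w ∈ GC v, dep w = 2 * m + 1 ∧ rk w = 1 ∧ cl w = sgn * c) ∧ (GC v).ncard = q ^ 2) := by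
  refine ⟨?_, ?_, ?_, ?_, ?_, ?_, ?_⟩
  · intro v hvF hv _ hvD hd2 hrk1
    exact engineRowGen_odd hσ hvσ hσϖ hϖ hres h2 B dep rk hdep hrk hBD v hvF hv hvD hd2 hrk1
  · intro v hvF hv hvr hvD hd0
    exact engineRowGen_B hσ hvσ hσϖ hϖ hres h2 hT hγ0 A s hs1 hγA heD B dep hdep hBD GC hGC v hvF hv hvr hvD hd0
  · intro v hvF hv hvr hvD hd1 hrk1
    exact engineRowGen_C hσ hvσ hσϖ hϖ hres h2 hT hγ0 A s hs1 hγA heD B dep rk hdep hrk hBD GC hGC horient v hvF hv hvr hvD hd1 hrk1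
  · intro v hvF hv hvr hvD hd1 hrk2
    exact engineRowGen_R hσ hvσ hσϖ hϖ hres h2 hT hγ0 A s hs1 hγA heD B dep rk hdep hrk hBD GC hGC q hq horient v hvF hv hvr hvD hd1 hrk2
  · intro v hvF hv hvr hvD m hdm hrk2
    exact engineRowGen_E hσ hvσ hσϖ hϖ hres h2 hT hγ0 A s hs1 hγA heD B dep rk hdep hrk hBD GC hGC q hq horient v hvF hv hvr hvD m hdm hrk2
  · intro v hvF hv hvr hvD m hdm hrk2
    exact engineRowGen_O hσ hvσ hσϖ hϖ hres h2 hT hγ0 A s hs1 hγA heD c₁ hc₁ B dep rk cl hdep hrk hcl hBD GC hGC q hq horient v hvF hv hvr hvD m hdm hrk2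
  · intro v hvF hv hvr hvD m c hdm hrk1 hclv
    exact engineRowGen_P hσ hvσ hσϖ hϖ hres h2 hT hγ0 A s hs1 hγA heD c₁ ε hc₁ hεv hε B dep rk cl hdep hrk hcl hBD GC hGC q hq sgn hsgn horient hsgnDict v hvF hv hvr hvD m c
      hdm hrk1 hclv

end Literature.NumberTheory.Automorphic.UnitaryLatticeTree

end
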